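import Mathlib
import HarnessLib
import Summits.NavierStokesRegularity.NavierStokesRegularity.Theorems.PoloidalWindowDoorPoloidalWindowRigiditySparseEnergySlabMean
import Summits.NavierStokesRegularity.NavierStokesRegularity.Theorems.PoloidalWindowDoorPoloidalWindowRigidityClassRate
import Summits.NavierStokesRegularity.NavierStokesRegularity.Theorems.PoloidalWindowDoorPoloidalWindowRigidityClebsch

/-!
# Route `PoloidalWindowDoor`, crux `PoloidalWindowRigidity` (stmt-19708), line `sparse_energy` (cstrat g11) —
# STUB S3 `stub_planeMeansVanish`: bounded scale-invariant energy ⇒ every horizontal plane mean of `|v|²` vanishes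

Seat ns-poloidal-K2-p2 g8 (interim LEAD-of-record on 19708).  The registered stub `stub_planeMeansVanish` of the line
`Cruxes/PoloidalWindowRigidity/Lines/sparse_energy.lean` (commit 579786377348), VERBATIM: for a profile of the route's Type-I class
(`‖v(t,x)‖ ≤ C/√(−t)`, continuous, Oseen-mild) whose scale-invariant energy is bounded (`∫_{B_R(a)} |v(t₀)|² ≤ K R` for all balls
and all `t₀ < 0`), every horizontal bump mean `hmean φ c R z (|v(t)|²)` (`…HorizontalMean`) is `≤ ε` for all `R ≥ R₀(φ,t,ε)`,
uniformly in the centre `c` and the height `z`.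

Proof (the line card's mechanism).  Fix `t < 0`; `F := |v(t)|²` is smooth, non-negative, and LIPSCHITZ IN THE VERTICAL DIRECTION with
constant `L = 2·(C/√(−t))·(C₁/(−t))` (`…ClassRate.exists_fderiv_rate_of_class`), so for every `h > 0`
`F(x) ≤ (2h)⁻¹ ∫_{−h}^{h} F(x + s e₂) ds + L h` (`le_verticalAverage_add`).  Averaging against the bump (mass one, `0 ≤ φ̄ ≤ Φ`,
supported in `B̄(0, r)`, `r = φ.rOut`) and using `…SparseEnergySlabMean.setIntegral_window_le_ball`,
`hmean φ c R z F ≤ (2h)⁻¹ Φ R⁻² ∫_{B(c + z e₂, R r + h)} F + L h ≤ (2h)⁻¹ Φ R⁻² K (R r + h) + L h`; with `h = R^{-1/2}` and `R ≥ 1`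
this is `≤ (Φ K (r+1)/2 + L)·R^{-1/2} → 0`.

WHAT THIS IS NOT: not a claim about Navier–Stokes regularity and not the crux — one registered stub (S3, size M) of ONE line; the
line's residue `stub_twistingSparse` and its class-level input `stub_scaledEnergy` stay open (bears_on LADDER-NS N0 via crux 19708).
-/

noncomputable section

-- the summit and its single sub-problem share the name (CONVENTIONS §1), as in every Theorems file
set_option linter.dupNamespace false

namespace Summit.NavierStokesRegularity.NavierStokesRegularity.Theorems.PoloidalWindowDoorPoloidalWindowRigiditySparseEnergyPlaneMeans

open MeasureTheory Set Function Filter Topology Metric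
open scoped RealInnerProductSpace InnerProductSpace ENNReal
open Literature.Analysis Literature.Analysis.FluidPDE
open Summit.NavierStokesRegularity.NavierStokesRegularity.Theorems.PoloidalWindowDoorPoloidalWindowRigidityHorizontalMean
open Summit.NavierStokesRegularity.NavierStokesRegularity.Theorems.PoloidalWindowDoorPoloidalWindowRigiditySparseEnergySlabMean
open Summit.NavierStokesRegularity.NavierStokesRegularity.Theorems.PoloidalWindowDoorPoloidalWindowRigidityClassRate
open Summit.NavierStokesRegularity.NavierStokesRegularity.Theorems.PoloidalWindowDoorPoloidalWindowRigidityClebsch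

/-! ### A vertically Lipschitz non-negative function is dominated by its vertical window averages -/

/-- **Vertical Lipschitz bound for `|u|²`.**  If `u : ℝ³ → ℝ³` is differentiable with `‖u‖ ≤ M₀` and `‖Du‖ ≤ M₁` everywhere
(`M₀, M₁ ≥ 0`), then `| |u(x + s e₂)|² − |u(x)|² | ≤ 2 M₀ M₁ |s|`. [folklore] -/
theorem abs_normSq_vertical_sub_le {u : EuclideanSpace ℝ (Fin 3) → EuclideanSpace ℝ (Fin 3)} (hu : Differentiable ℝ u)
    {M₀ M₁ : ℝ} (hM₀ : 0 ≤ M₀) (h0 : ∀ x, ‖u x‖ ≤ M₀) (h1 : ∀ x, ‖fderiv ℝ u x‖ ≤ M₁)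
    (x : EuclideanSpace ℝ (Fin 3)) (s : ℝ) :
    |‖u (x + s • EuclideanSpace.single 2 1)‖ ^ 2 - ‖u x‖ ^ 2| ≤ 2 * M₀ * M₁ * |s| := by
  set e : EuclideanSpace ℝ (Fin 3) := EuclideanSpace.single 2 1 with he
  have hen : ‖e‖ = 1 := by simp [he]
  set γ : ℝ → ℝ := fun σ => ‖u (x + σ • e)‖ ^ 2 with hγ
  -- derivative of `γ` along the vertical line
  have hline : ∀ σ : ℝ, HasDerivAt (fun σ : ℝ => x + σ • e) e σ := fun σ => by
    simpa using ((hasDerivAt_id σ).smul_const e).const_add x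
  have hderiv : ∀ σ : ℝ, HasDerivAt γ (2 * ⟪u (x + σ • e), fderiv ℝ u (x + σ • e) e⟫_ℝ) σ := by
    intro σ
    have hu' : HasFDerivAt u (fderiv ℝ u (x + σ • e)) (x + σ • e) := (hu _).hasFDerivAt
    have hcomp : HasDerivAt (fun σ : ℝ => u (x + σ • e)) (fderiv ℝ u (x + σ • e) e) σ :=
      hu'.comp_hasDerivAt σ (hline σ)
    have h := hcomp.norm_sq
    simpa [hγ, real_inner_comm] using h
  have hbound : ∀ σ : ℝ, ‖deriv γ σ‖ ≤ 2 * M₀ * M₁ := by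
    intro σ
    rw [(hderiv σ).deriv, Real.norm_eq_abs, abs_mul, abs_two]
    have hin : |⟪u (x + σ • e), fderiv ℝ u (x + σ • e) e⟫_ℝ| ≤ M₀ * M₁ := by
      calc |⟪u (x + σ • e), fderiv ℝ u (x + σ • e) e⟫_ℝ|
          ≤ ‖u (x + σ • e)‖ * ‖fderiv ℝ u (x + σ • e) e‖ := abs_real_inner_le_norm _ _
        _ ≤ M₀ * (M₁ * 1) := by
            refine mul_le_mul (h0 _) ?_ (norm_nonneg _) hM₀
            calc ‖fderiv ℝ u (x + σ • e) e‖ ≤ ‖fderiv ℝ u (x + σ • e)‖ * ‖e‖ := ContinuousLinearMap.le_opNorm _ _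
              _ ≤ M₁ * 1 := by rw [hen]; exact mul_le_mul_of_nonneg_right (h1 _) zero_le_one
        _ = M₀ * M₁ := by ring
    linarith
  have hmvt := Convex.norm_image_sub_le_of_norm_deriv_le (f := γ) (s := univ) (x := 0) (y := s)
    (fun σ _ => (hderiv σ).differentiableAt) (fun σ _ => hbound σ) convex_univ (mem_univ _) (mem_univ _)
  simp only [hγ, zero_smul, add_zero, sub_zero, Real.norm_eq_abs] at hmvt
  linarith

/-- **A vertically Lipschitz function is below its vertical window average plus `L h`.**  If `|G(x + s e₂) − G(x)| ≤ L|s|` for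
all `s` and `G ∘ (x + · e₂)` is continuous, then `G(x) ≤ (2h)⁻¹ ∫_{s ∈ [−h,h]} G(x + s e₂) ds + L h` for `h > 0`. [folklore] -/
theorem le_verticalAverage_add {G : EuclideanSpace ℝ (Fin 3) → ℝ} (hG : Continuous G) {L : ℝ}
    (x : EuclideanSpace ℝ (Fin 3)) (hLip : ∀ s : ℝ, |G (x + s • EuclideanSpace.single 2 1) - G x| ≤ L * |s|)
    {h : ℝ} (hh : 0 < h) :
    G x ≤ (2 * h)⁻¹ * (∫ s in Icc (-h) h, G (x + s • EuclideanSpace.single 2 1)) + L * h := by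
  have hcont : Continuous fun s : ℝ => G (x + s • EuclideanSpace.single 2 1) := by fun_prop
  have hint : IntegrableOn (fun s : ℝ => G (x + s • EuclideanSpace.single 2 1)) (Icc (-h) h) :=
    hcont.continuousOn.integrableOn_compact isCompact_Icc
  have hvol : (volume : Measure ℝ).real (Icc (-h) h) = 2 * h := by
    rw [Real.volume_real_Icc_of_le (by linarith)]; ring
  -- pointwise: `G x − L h ≤ G(x + s e₂)` on the window
  have hpt : ∀ s ∈ Icc (-h) h, G x - L * h ≤ G (x + s • EuclideanSpace.single 2 1) := by
    intro s hs
    have h1 := hLip s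
    have hs' : |s| ≤ h := abs_le.2 ⟨by linarith [hs.1], hs.2⟩
    have hL : L * |s| ≤ |L| * h := by
      calc L * |s| ≤ |L| * |s| := mul_le_mul_of_nonneg_right (le_abs_self L) (abs_nonneg s)
        _ ≤ |L| * h := mul_le_mul_of_nonneg_left hs' (abs_nonneg L)
    have h2 : G x - G (x + s • EuclideanSpace.single 2 1) ≤ L * |s| := by
      have := (abs_le.1 h1).1; linarith
    -- we only need `L|s| ≤ L h` when `L ≥ 0`; in general use `L|s| ≤ max L 0 · h`? No: the hypothesis with `s` and `−s` forces `L|s| ≥ 0`.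
    have hL0 : 0 ≤ L * |s| := le_trans (abs_nonneg _) h1
    rcases eq_or_lt_of_le (abs_nonneg s) with h0 | hpos
    · have : s = 0 := abs_eq_zero.1 h0.symm
      subst this; simp only [zero_smul, add_zero]
      have : 0 ≤ L * h := by
        have hh1 := hLip h
        have : 0 ≤ L * |h| := le_trans (abs_nonneg _) hh1
        rwa [abs_of_pos hh] at this
      linarith
    · have hLnn : 0 ≤ L := by
        by_contra hneg; rw [not_le] at hneg
        have : L * |s| < 0 := mul_neg_of_neg_of_pos hneg hpos
        linarith
      have : L * |s| ≤ L * h := mul_le_mul_of_nonneg_left hs' hLnn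
      linarith
  have hconst : ∫ s in Icc (-h) h, (G x - L * h) = (G x - L * h) * (2 * h) := by
    rw [setIntegral_const, hvol, smul_eq_mul, mul_comm]
  have hmono : ∫ s in Icc (-h) h, (G x - L * h) ≤ ∫ s in Icc (-h) h, G (x + s • EuclideanSpace.single 2 1) :=
    setIntegral_mono_on (integrableOn_const (by rw [Real.volume_Icc]; exact ENNReal.ofReal_lt_top |>.ne) ) hint
      measurableSet_Icc hpt
  rw [hconst] at hmono
  have h2h : 0 < 2 * h := by linarith
  have := (le_div_iff₀ h2h).2 hmono
  rw [div_eq_inv_mul] at this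
  linarith


/-! ### The stub -/

/-- **STUB S3 `stub_planeMeansVanish` of line `sparse_energy` — PROVED.**  For a profile of the route's Type-I class whose
scale-invariant energy is bounded by `K·R` on every ball at every negative time, every horizontal bump mean of `|v(t)|²` is
eventually `≤ ε` as the scale `R → ∞`, uniformly in the centre and the height (statement VERBATIM the registered stub of
`Cruxes/PoloidalWindowRigidity/Lines/sparse_energy.lean`; vertical Lipschitz bound from `…ClassRate.exists_fderiv_rate_of_class`,
slab average from `…SparseEnergySlabMean.setIntegral_window_le_ball`, half-thickness `h = R^{-1/2}`). [folklore] -/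
theorem stub_planeMeansVanish :
    ∀ (C : ℝ) (v : ℝ → EuclideanSpace ℝ (Fin 3) → EuclideanSpace ℝ (Fin 3)),
      Literature.Analysis.FluidPDE.HasTypeITimeDecay C v →
      ContinuousOn (Function.uncurry v) (Set.Iio (0 : ℝ) ×ˢ Set.univ) →
      (∀ s t : ℝ, s < t → t < 0 → ∀ x, v t x =
        Literature.Analysis.UnboundedOperators.heatExtension (v s) (t - s) x -
          Literature.Analysis.FluidPDE.oseenDuhamel 1 s v v t x) →
      ∀ K : ℝ, 0 ≤ K →
        (∀ t₀ : ℝ, t₀ < 0 → ∀ (a : EuclideanSpace ℝ (Fin 3)) (R : ℝ), 0 < R →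
          (∫⁻ x in Metric.ball a R, ENNReal.ofReal (‖v t₀ x‖ ^ 2)) ≤ ENNReal.ofReal (K * R) ∧
          (∫⁻ t in Set.Iio t₀, ∫⁻ x in Metric.ball a R, ENNReal.ofReal (‖fderiv ℝ (v t) x‖ ^ 2)) ≤ ENNReal.ofReal (K * R)) →
        ∀ (φ : ContDiffBump (0 : EuclideanSpace ℝ (Fin 2))) (t : ℝ), t < 0 → ∀ ε : ℝ, 0 < ε →
          ∃ R₀ : ℝ, 0 < R₀ ∧ ∀ R : ℝ, R₀ ≤ R → ∀ (c : EuclideanSpace ℝ (Fin 3)) (z : ℝ),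
            hmean φ c R z (fun x => ‖v t x‖ ^ 2) ≤ ε := by
  intro C v hrate hcont hmild K hK0 hK φ t ht ε hε
  -- constants at the fixed time `t`
  have hvM : ∀ x, ‖v t x‖ ≤ C / Real.sqrt (-t) := fun x => hrate t ht x
  have hM₀0 : 0 ≤ C / Real.sqrt (-t) := le_trans (norm_nonneg _) (hvM 0)
  obtain ⟨C₁, hC₁⟩ := exists_fderiv_rate_of_class hrate hcont hmild
  have hDvM : ∀ x, ‖fderiv ℝ (v t) x‖ ≤ C₁ / (-t) := fun x => hC₁ t ht x
  have hM₁0 : 0 ≤ C₁ / (-t) := le_trans (norm_nonneg _) (hDvM 0)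
  have hdiff : Differentiable ℝ (v t) := (contDiff_slice hrate hcont hmild ht).differentiable (by simp)
  set F : EuclideanSpace ℝ (Fin 3) → ℝ := fun x => ‖v t x‖ ^ 2 with hF
  have hFc : Continuous F := (hdiff.continuous.norm).pow 2
  have hF0 : ∀ x, 0 ≤ F x := fun x => by positivity
  set L : ℝ := 2 * (C / Real.sqrt (-t)) * (C₁ / (-t)) with hL
  have hL0 : 0 ≤ L := by positivity
  have hLip : ∀ (x : EuclideanSpace ℝ (Fin 3)) (s : ℝ), |F (x + s • EuclideanSpace.single 2 1) - F x| ≤ L * |s| :=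
    fun x s => abs_normSq_vertical_sub_le hdiff hM₀0 hvM hDvM x s
  -- the bump: bounded by `Φ`, supported in the closed disc of radius `r = φ.rOut`
  obtain ⟨Φ, hΦ⟩ := (φ.hasCompactSupport_normed (μ := volume)).exists_bound_of_continuous φ.continuous_normed
  have hΦ0 : 0 ≤ Φ := le_trans (norm_nonneg _) (hΦ 0)
  set r : ℝ := φ.rOut with hr
  have hr0 : 0 < r := φ.rOut_pos
  -- the threshold
  set A : ℝ := Φ * K * (r + 1) / 2 + L with hA
  have hA0 : 0 ≤ A := by positivity
  refine ⟨max 1 ((A / ε) ^ 2 + 1), lt_max_of_lt_left one_pos, fun R hR c z => ?_⟩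
  have hR1 : 1 ≤ R := le_trans (le_max_left _ _) hR
  have hR0 : 0 < R := lt_of_lt_of_le one_pos hR1
  have hRA : (A / ε) ^ 2 + 1 ≤ R := le_trans (le_max_right _ _) hR
  set q : ℝ := Real.sqrt R with hq
  have hq0 : 0 < q := Real.sqrt_pos.2 hR0
  have hq1 : 1 ≤ q := by rw [hq]; exact Real.one_le_sqrt.2 hR1
  have hqR : q ^ 2 = R := Real.sq_sqrt hR0.le
  set h : ℝ := q⁻¹ with hh
  have hh0 : 0 < h := inv_pos.2 hq0
  have hh1 : h ≤ 1 := inv_le_one_of_one_le₀ hq1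
  have hhR : h ≤ R := le_trans hh1 hR1
  -- Step 1: `F` is below its vertical window average, pointwise, hence in the mean
  set W : EuclideanSpace ℝ (Fin 3) → ℝ := fun x => ∫ s in Icc (-h) h, F (x + s • EuclideanSpace.single 2 1) with hW
  have hWc : Continuous W := by
    have hu : Continuous (Function.uncurry fun (x : EuclideanSpace ℝ (Fin 3)) (s : ℝ) =>
        F (x + s • EuclideanSpace.single 2 1)) :=
      hFc.comp (continuous_fst.add (continuous_snd.smul continuous_const))
    exact continuous_parametric_integral_of_continuous hu isCompact_Icc
  have hFG : ∀ x, F x ≤ (2 * h)⁻¹ * W x + L * h := fun x => le_verticalAverage_add hFc x (hLip x) hh0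
  have hc1 : Continuous fun x => (2 * h)⁻¹ * W x := continuous_const.mul hWc
  have hGc : Continuous fun x => (2 * h)⁻¹ * W x + L * h := hc1.add continuous_const
  have hstep1 : hmean φ c R z F ≤ (2 * h)⁻¹ * hmean φ c R z W + L * h := by
    have h1 := hmean_mono φ c R z hFc hGc hFG
    rwa [hmean_add φ c R z hc1 continuous_const, hmean_const_mul φ c R z, hmean_const φ c R z] at h1
  -- Step 2: the mean of the window integral against the bump is a window of plane integrals over the disc
  have hW0 : ∀ y : EuclideanSpace ℝ (Fin 2), 0 ≤ W (pt c R z y) := fun y =>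
    setIntegral_nonneg measurableSet_Icc fun s _ => hF0 _
  have hWpt : Continuous fun y : EuclideanSpace ℝ (Fin 2) => W (pt c R z y) := hWc.comp (continuous_pt c R z)
  have hle : ∀ y : EuclideanSpace ℝ (Fin 2), W (pt c R z y) * φ.normed volume y ≤
      Φ * (closedBall (0 : EuclideanSpace ℝ (Fin 2)) r).indicator (fun y => W (pt c R z y)) y := by
    intro y
    by_cases hy : y ∈ closedBall (0 : EuclideanSpace ℝ (Fin 2)) r
    · rw [indicator_of_mem hy]
      have hb := hΦ y
      rw [Real.norm_of_nonneg (φ.nonneg_normed y)] at hb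
      calc W (pt c R z y) * φ.normed volume y ≤ W (pt c R z y) * Φ := mul_le_mul_of_nonneg_left hb (hW0 y)
        _ = Φ * W (pt c R z y) := mul_comm _ _
    · have hzero : φ.normed volume y = 0 := by
        have hy' : y ∉ tsupport (φ.normed volume) := by rw [φ.tsupport_normed_eq]; exact hy
        exact image_eq_zero_of_notMem_tsupport hy'
      rw [hzero, mul_zero, indicator_of_notMem hy, mul_zero]
  have hstep2 : hmean φ c R z W ≤ Φ * ∫ y in closedBall (0 : EuclideanSpace ℝ (Fin 2)) r, W (pt c R z y) := by
    show ∫ y, W (pt c R z y) * φ.normed volume y ≤ _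
    have hi1 : Integrable fun y => W (pt c R z y) * φ.normed volume y := integrable_mul_normed φ hWpt
    have hi2 : Integrable fun y => Φ * (closedBall (0 : EuclideanSpace ℝ (Fin 2)) r).indicator (fun y => W (pt c R z y)) y :=
      ((hWpt.continuousOn.integrableOn_compact (isCompact_closedBall _ _)).integrable_indicator
        measurableSet_closedBall).const_mul Φ
    calc ∫ y, W (pt c R z y) * φ.normed volume y
        ≤ ∫ y, Φ * (closedBall (0 : EuclideanSpace ℝ (Fin 2)) r).indicator (fun y => W (pt c R z y)) y :=
          integral_mono hi1 hi2 hle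
      _ = Φ * ∫ y in closedBall (0 : EuclideanSpace ℝ (Fin 2)) r, W (pt c R z y) := by
          rw [integral_const_mul, integral_indicator measurableSet_closedBall]
  -- Step 3: the window of plane integrals is controlled by a ball, whose energy is `≤ K (R r + h)`
  have hstep3 : ∫ y in closedBall (0 : EuclideanSpace ℝ (Fin 2)) r, W (pt c R z y) ≤
      (R ^ 2)⁻¹ * ∫ x in ball (c + z • EuclideanSpace.single 2 1) (R * r + h), F x :=
    setIntegral_window_le_ball hFc hF0 c hR0 z hr0 hh0
  have hρ : 0 < R * r + h := by positivity
  have hball : ∫ x in ball (c + z • EuclideanSpace.single 2 1) (R * r + h), F x ≤ K * (R * r + h) := by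
    have hKb := (hK t ht (c + z • EuclideanSpace.single 2 1) (R * r + h) hρ).1
    have hint : IntegrableOn F (ball (c + z • EuclideanSpace.single 2 1) (R * r + h)) :=
      (hFc.continuousOn.integrableOn_compact (isCompact_closedBall _ _)).mono_set ball_subset_closedBall
    rw [integral_eq_lintegral_of_nonneg_ae (ae_of_all _ fun x => hF0 x) hint.aestronglyMeasurable]
    exact ENNReal.toReal_le_of_le_ofReal (by positivity) hKb
  -- Step 4: arithmetic with `h = R^{-1/2}`
  have hwin : (R ^ 2)⁻¹ * (K * (R * r + h)) ≤ K * (r + 1) / q ^ 2 := by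
    rw [hqR]
    have h1 : K * (R * r + h) ≤ K * (R * (r + 1)) := by
      apply mul_le_mul_of_nonneg_left _ hK0; nlinarith
    calc (R ^ 2)⁻¹ * (K * (R * r + h)) ≤ (R ^ 2)⁻¹ * (K * (R * (r + 1))) :=
          mul_le_mul_of_nonneg_left h1 (inv_nonneg.2 (sq_nonneg R))
      _ = K * (r + 1) / R := by field_simp
  have hmeanW : hmean φ c R z W ≤ Φ * (K * (r + 1) / q ^ 2) := by
    calc hmean φ c R z W ≤ Φ * ∫ y in closedBall (0 : EuclideanSpace ℝ (Fin 2)) r, W (pt c R z y) := hstep2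
      _ ≤ Φ * ((R ^ 2)⁻¹ * ∫ x in ball (c + z • EuclideanSpace.single 2 1) (R * r + h), F x) :=
          mul_le_mul_of_nonneg_left hstep3 hΦ0
      _ ≤ Φ * ((R ^ 2)⁻¹ * (K * (R * r + h))) := by
          apply mul_le_mul_of_nonneg_left _ hΦ0
          exact mul_le_mul_of_nonneg_left hball (inv_nonneg.2 (sq_nonneg R))
      _ ≤ Φ * (K * (r + 1) / q ^ 2) := mul_le_mul_of_nonneg_left hwin hΦ0
  have h2h : 0 ≤ (2 * h)⁻¹ := by positivity
  have hkey : hmean φ c R z F ≤ A / q := by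
    calc hmean φ c R z F ≤ (2 * h)⁻¹ * hmean φ c R z W + L * h := hstep1
      _ ≤ (2 * h)⁻¹ * (Φ * (K * (r + 1) / q ^ 2)) + L * h := by
          have := mul_le_mul_of_nonneg_left hmeanW h2h; linarith
      _ = A / q := by rw [hA, hh]; field_simp
  have hfin : A / q ≤ ε := by
    have hlt : A / ε < q := by
      calc A / ε = Real.sqrt ((A / ε) ^ 2) := (Real.sqrt_sq (div_nonneg hA0 hε.le)).symm
        _ < Real.sqrt R := Real.sqrt_lt_sqrt (sq_nonneg _) (by linarith)
    rw [div_le_iff₀ hq0]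
    have := (div_lt_iff₀ hε).1 hlt
    linarith
  exact hkey.trans hfin

end Summit.NavierStokesRegularity.NavierStokesRegularity.Theorems.PoloidalWindowDoorPoloidalWindowRigiditySparseEnergyPlaneMeans

end
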